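import Summits.Parity.BatemanHorn.Theorems.AlmostPrimeZerosSystemLSDRealSegmentNairSystem
import Literature.NumberTheory.LFunctions.PolynomialRootMertensFirst
import HarnessLib

/-!
# The smooth part of the kernel: Mertens along the system with Rankin's twist

Crux `SystemLSDRealSegment` (stmt-Parity-11292, route `AlmostPrimeZeros`), line `beta-thinned-root-kernel`, support
programme of the lead c9 (localisation of the kernel to rough divisor tuples).  Rankin's trick with exponent
`δ = 2/log S` and Nair–Tenenbaum light (`nairTenenbaumLight`, file `…NairMain`) bound the `S`-smooth part of the kernel by
`C·N·exp(Σ_{p ≤ N} (G̃(p) − 1) ρ_f(p)/p)` for the twisted weight `G̃(p) = 1 + (y−1) p^δ` (`p < S`), `G̃(p) = 1` (`p ≥ S`),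
`ρ_f(p) = polyRootCountMod f p`.  This file proves the registered stub `stub_twistedMertens_exponent` of the skeleton:
the exponent is `≤ (y−1)·k·log log S + B` uniformly in `S ≥ 2` and in the length `x` of the sum.

Proof.  The summand vanishes for `p ≥ S` and is `≥ 0`, so the sum is at most `(y−1) Σ_{p ≤ S} p^δ ρ_f(p)/p`.  For a prime
`p ≤ S`, `p^δ = e^t` with `t = 2 log p/log S ∈ [0, 2]` and `e^t ≤ 1 + t e^t ≤ 1 + e² t` (`1 − t ≤ e^{−t}`), so the sum is
at most `(y−1)·[Σ_{p ≤ S} ρ_f(p)/p + (2e²/log S)·Σ_{p ≤ S} ρ_f(p) log p/p]`; finally `Σ_{p ≤ S} ρ_f(p)/p ≤ k log log S + C₁`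
(`Nair.exists_sum_rootCount_div_le`, file `…NairSystem`) and `Σ_{p ≤ S} ρ_f(p) log p/p ≤ k log S + C₂` (union bound over
the members, `Nair.polyRootCountMod_prod_le_sum`, and Landau's Mertens theorem for the roots of each irreducible member,
`Literature.NumberTheory.LFunctions.DegreeOnePrimes.abs_sum_primesLE_rootCount_mul_log_div_sub_log_le`), whence
`B = (y−1)(C₁ + 2e²k + 2e²|C₂|/log 2)`.  Everything here is PROVED; no definitions.
-/

open Filter Finset Polynomial Real
open scoped BigOperators

namespace Summit.Parity.BatemanHorn.Cruxes.SystemLSDRealSegment.BetaThinnedRootKernel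

open Literature.NumberTheory.Sieve

noncomputable section

/-- **Mertens' first theorem along a Bateman–Horn system, from above**: for a Bateman–Horn system `f` of `k` members
there is `C` with `Σ_{p ≤ Q} ρ_f(p) log p/p ≤ k log Q + C` for all integers `Q ≥ 2` (union bound
`ρ_f(p) = ρ_{∏ fᵢ}(p) ≤ Σᵢ ρ_{fᵢ}(p)` at primes, and Landau's `|Σ_{p ≤ Q} ρ_{fᵢ}(p) log p/p − log Q| ≤ Cᵢ` for each
irreducible non-constant member). [folklore] -/
theorem twistedMertens_sum_rootCount_mul_log_div_le {k : ℕ} {f : Fin k → ℤ[X]} (hf : IsBatemanHornSystem f) :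
    ∃ C : ℝ, ∀ Q : ℕ, 2 ≤ Q →
      ∑ p ∈ Nat.primesLE Q, (polyRootCountMod f p : ℝ) * Real.log p / p ≤ k * Real.log Q + C := by
  choose C hC using fun i =>
    Literature.NumberTheory.LFunctions.DegreeOnePrimes.abs_sum_primesLE_rootCount_mul_log_div_sub_log_le (f i)
      (hf.irreducible i) (hf.natDegree_pos i)
  refine ⟨∑ i, C i, fun Q hQ => ?_⟩
  have h1 : ∀ p ∈ Nat.primesLE Q, (polyRootCountMod f p : ℝ) * Real.log p / p ≤
      ∑ i, (polyRootCountMod ![f i] p : ℝ) * Real.log p / p := by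
    intro p hp
    have hpr := Nat.prime_of_mem_primesLE hp
    have hp0 : (0 : ℝ) < p := by exact_mod_cast hpr.pos
    have hlog : 0 ≤ Real.log p := Real.log_natCast_nonneg p
    rw [← Finset.sum_div, ← Finset.sum_mul]
    refine div_le_div_of_nonneg_right (mul_le_mul_of_nonneg_right ?_ hlog) hp0.le
    rw [PolyPrimeCountBrun.polyRootCountMod_eq_single_prod]
    exact_mod_cast Nair.polyRootCountMod_prod_le_sum f hpr
  calc ∑ p ∈ Nat.primesLE Q, (polyRootCountMod f p : ℝ) * Real.log p / p
      ≤ ∑ p ∈ Nat.primesLE Q, ∑ i, (polyRootCountMod ![f i] p : ℝ) * Real.log p / p := Finset.sum_le_sum h1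
    _ = ∑ i, ∑ p ∈ Nat.primesLE Q, (polyRootCountMod ![f i] p : ℝ) * Real.log p / p := Finset.sum_comm
    _ ≤ ∑ i, (Real.log Q + C i) := Finset.sum_le_sum fun i _ => by
        have h := (abs_le.mp (hC i Q hQ)).2
        linarith
    _ = k * Real.log Q + ∑ i, C i := by
        rw [Finset.sum_add_distrib, Finset.sum_const, Finset.card_univ, Fintype.card_fin, nsmul_eq_mul]

/-- `e^t ≤ 1 + e²·t` for `0 ≤ t ≤ 2`: from `1 − t ≤ e^{−t}` one gets `e^t ≤ 1 + t e^t`, and `e^t ≤ e²`. [folklore] -/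
theorem twistedMertens_exp_le_one_add_exp_two_mul {t : ℝ} (h0 : 0 ≤ t) (h2 : t ≤ 2) :
    Real.exp t ≤ 1 + Real.exp 2 * t := by
  have h1 : -t + 1 ≤ Real.exp (-t) := Real.add_one_le_exp (-t)
  have hpos : 0 < Real.exp t := Real.exp_pos t
  have h3 : Real.exp t * Real.exp (-t) = 1 := by rw [← Real.exp_add, add_neg_cancel, Real.exp_zero]
  have h4 : Real.exp t ≤ Real.exp 2 := Real.exp_le_exp.mpr h2
  have h5 : Real.exp t * (-t + 1) ≤ 1 := by
    have := mul_le_mul_of_nonneg_left h1 hpos.le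
    rwa [h3] at this
  have h6 : Real.exp t * t ≤ Real.exp 2 * t := mul_le_mul_of_nonneg_right h4 h0
  nlinarith [h5, h6]

/-- **stub_twistedMertens_exponent** (Mertens along the system, twisted; registered stub of the skeleton of line
`beta-thinned-root-kernel`): for a Bateman–Horn system `f` and `y ≥ 1` there is `B` with
`Σ_{p ≤ x} (G̃(p) − 1) ρ_f(p)/p ≤ (y−1)·k·log log S + B` for all `S ≥ 2` and all `x`, where `G̃(p) = 1 + (y−1) p^{2/log S}`
for `p < S` and `G̃(p) = 1` for `p ≥ S` (`p^{2/log S} ≤ 1 + 2e² log p/log S` for `p ≤ S`; `Σ_{p ≤ S} ρ_f(p)/p ≤ k log log S + O(1)`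
and `Σ_{p ≤ S} ρ_f(p) log p/p ≤ k log S + O(1)`, the latter from Landau's prime ideal theorem for each member). [folklore] -/
theorem stub_twistedMertens_exponent :
    ∀ (k : ℕ) (f : Fin k → ℤ[X]), IsBatemanHornSystem f → ∀ y : ℝ, 1 ≤ y → ∃ B : ℝ, ∀ S : ℕ, 2 ≤ S → ∀ x : ℕ,
      ∑ p ∈ Nat.primesLE x,
          ((if p < S then 1 + (y - 1) * (p : ℝ) ^ (2 / Real.log S) else 1) - 1) *
            (polyRootCountMod f p : ℝ) / p ≤
        (y - 1) * k * Real.log (Real.log S) + B := by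
  intro k f hf y hy
  obtain ⟨C₁, hC₁⟩ := Nair.exists_sum_rootCount_div_le hf
  obtain ⟨C₂, hC₂⟩ := twistedMertens_sum_rootCount_mul_log_div_le hf
  refine ⟨(y - 1) * (C₁ + 2 * Real.exp 2 * k + 2 * Real.exp 2 * |C₂| / Real.log 2), fun S hS x => ?_⟩
  set ρ : ℕ → ℝ := fun p => (polyRootCountMod f p : ℝ) with hρ
  have hy0 : 0 ≤ y - 1 := sub_nonneg.mpr hy
  have hS1 : (1 : ℝ) < S := by exact_mod_cast hS
  have hlogS : 0 < Real.log S := Real.log_pos hS1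
  have hlog2 : 0 < Real.log 2 := Real.log_pos one_lt_two
  have hlog2S : Real.log 2 ≤ Real.log S := Real.log_le_log two_pos (by exact_mod_cast hS)
  have hδ0 : 0 ≤ 2 / Real.log S := div_nonneg two_pos.le hlogS.le
  have hρ0 : ∀ p, 0 ≤ ρ p := fun p => Nat.cast_nonneg _
  -- the majorant `h(p) = (y − 1) p^δ ρ(p)/p ≥ 0` of the summand, supported on `p < S`
  set h : ℕ → ℝ := fun p => (y - 1) * ((p : ℝ) ^ (2 / Real.log S) * ρ p / p) with hh
  have hh0 : ∀ p, 0 ≤ h p := fun p =>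
    mul_nonneg hy0 (div_nonneg (mul_nonneg (Real.rpow_nonneg (Nat.cast_nonneg _) _) (hρ0 p)) (Nat.cast_nonneg _))
  have key : ∀ p ∈ Nat.primesLE x,
      ((if p < S then 1 + (y - 1) * (p : ℝ) ^ (2 / Real.log S) else 1) - 1) * ρ p / p ≤
        if p < S then h p else 0 := by
    intro p _
    split_ifs with hpS
    · simp only [hh]
      exact le_of_eq (by ring)
    · simp
  -- pointwise: `p^δ ρ/p ≤ ρ/p + (2e²/log S) · ρ log p/p` for primes `p ≤ S`
  have hpt : ∀ p ∈ Nat.primesLE S, (p : ℝ) ^ (2 / Real.log S) * ρ p / p ≤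
      ρ p / p + 2 * Real.exp 2 / Real.log S * (ρ p * Real.log p / p) := by
    intro p hp
    obtain ⟨hpS, hpr⟩ := Nat.mem_primesLE.mp hp
    have hp0 : (0 : ℝ) < p := by exact_mod_cast hpr.pos
    have hlogp : 0 ≤ Real.log p := Real.log_natCast_nonneg p
    have hlogpS : Real.log p ≤ Real.log S := Real.log_le_log hp0 (by exact_mod_cast hpS)
    have ht0 : 0 ≤ Real.log p * (2 / Real.log S) := mul_nonneg hlogp hδ0
    have ht2 : Real.log p * (2 / Real.log S) ≤ 2 := by
      rw [mul_div_assoc', div_le_iff₀ hlogS]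
      linarith
    have hexp : (p : ℝ) ^ (2 / Real.log S) ≤ 1 + Real.exp 2 * (Real.log p * (2 / Real.log S)) := by
      rw [Real.rpow_def_of_pos hp0]
      exact twistedMertens_exp_le_one_add_exp_two_mul ht0 ht2
    have hmul := mul_le_mul_of_nonneg_right hexp (div_nonneg (hρ0 p) hp0.le)
    calc (p : ℝ) ^ (2 / Real.log S) * ρ p / p = (p : ℝ) ^ (2 / Real.log S) * (ρ p / p) := mul_div_assoc _ _ _
      _ ≤ (1 + Real.exp 2 * (Real.log p * (2 / Real.log S))) * (ρ p / p) := hmul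
      _ = ρ p / p + 2 * Real.exp 2 / Real.log S * (ρ p * Real.log p / p) := by ring
  calc ∑ p ∈ Nat.primesLE x,
        ((if p < S then 1 + (y - 1) * (p : ℝ) ^ (2 / Real.log S) else 1) - 1) * ρ p / p
      ≤ ∑ p ∈ Nat.primesLE x, (if p < S then h p else 0) := Finset.sum_le_sum key
    _ = ∑ p ∈ (Nat.primesLE x).filter (· < S), h p := (Finset.sum_filter _ _).symm
    _ ≤ ∑ p ∈ Nat.primesLE S, h p := by
        refine Finset.sum_le_sum_of_subset_of_nonneg (fun p hp => ?_) fun p _ _ => hh0 p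
        rw [Finset.mem_filter, Nat.mem_primesLE] at hp
        exact Nat.mem_primesLE.mpr ⟨hp.2.le, hp.1.2⟩
    _ = (y - 1) * ∑ p ∈ Nat.primesLE S, (p : ℝ) ^ (2 / Real.log S) * ρ p / p := by rw [Finset.mul_sum]
    _ ≤ (y - 1) * (∑ p ∈ Nat.primesLE S, ρ p / p +
          2 * Real.exp 2 / Real.log S * ∑ p ∈ Nat.primesLE S, ρ p * Real.log p / p) := by
        refine mul_le_mul_of_nonneg_left ?_ hy0
        rw [Finset.mul_sum, ← Finset.sum_add_distrib]
        exact Finset.sum_le_sum hpt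
    _ ≤ (y - 1) * ((k * Real.log (Real.log S) + C₁) +
          (2 * Real.exp 2 * k + 2 * Real.exp 2 * |C₂| / Real.log 2)) := by
        refine mul_le_mul_of_nonneg_left (add_le_add (hC₁ S hS) ?_) hy0
        have hA : 0 ≤ 2 * Real.exp 2 / Real.log S := div_nonneg (by positivity) hlogS.le
        calc 2 * Real.exp 2 / Real.log S * ∑ p ∈ Nat.primesLE S, ρ p * Real.log p / p
            ≤ 2 * Real.exp 2 / Real.log S * (k * Real.log S + C₂) := mul_le_mul_of_nonneg_left (hC₂ S hS) hA
          _ = 2 * Real.exp 2 * k + 2 * Real.exp 2 * (C₂ / Real.log S) := by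
              field_simp
          _ ≤ 2 * Real.exp 2 * k + 2 * Real.exp 2 * (|C₂| / Real.log 2) := by
              have h1 : C₂ / Real.log S ≤ |C₂| / Real.log S :=
                div_le_div_of_nonneg_right (le_abs_self _) hlogS.le
              have h2 : |C₂| / Real.log S ≤ |C₂| / Real.log 2 :=
                div_le_div_of_nonneg_left (abs_nonneg _) hlog2 hlog2S
              nlinarith [Real.exp_pos 2]
          _ = 2 * Real.exp 2 * k + 2 * Real.exp 2 * |C₂| / Real.log 2 := by ring
    _ = (y - 1) * k * Real.log (Real.log S) +
          (y - 1) * (C₁ + 2 * Real.exp 2 * k + 2 * Real.exp 2 * |C₂| / Real.log 2) := by ring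

end

end Summit.Parity.BatemanHorn.Cruxes.SystemLSDRealSegment.BetaThinnedRootKernel
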